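import Summits.QuantumFields.YangMills.Theorems.BalabanLadderNTReferenceMargins
import Summits.QuantumFields.YangMills.Theorems.BalabanLadderNTReferenceThreePointNoE2
import Summits.QuantumFields.YangMills.Theorems.BalabanLadderNTCumulantPolarisationDefs
import Summits.QuantumFields.YangMills.Theorems.LangevinControlUVOSLegsFromFemtoAndGapStubCollar
import Summits.QuantumFields.YangMills.Theorems.LangevinControlUVOSLegsFromFemtoAndGapStubAssemblyUniformBoundMain
import HarnessLib

/-!
# Crux `NT` (stmt-QuantumFields-19353), registered stub `stub_refpkgT : RefPkgT`: THE ONE-POINT CEILING PRICES THE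
# FLOORS — clause 1 (E1-osc, constant `C₁`) caps the torus two- and three-point functions of the action density

Helper file (`--supports stmt-QuantumFields-19353`) of the fleet lead prover of crux `NT` (unit `ym-spine-19353-p1`,
GEN 12); hypothesis-free, general compact `G`, any lattice representation `r`, ONE coupling `β`, every odd torus.

THE LEVER.  Clause 1 of the registered package (`|kerE^η(dens x) − kerE^{η'}(dens x)| ≤ C₁/depth⁴` on every femto cube,
every pair of exteriors) is not only an INPUT of the floor transfer (clauses 4–5): run through the tree's torus-DLR
collar (`LatticeGaugeDLRFarFactorProofs.abs_integral_prod_sub_mean_le`, the mechanism of the landed `stub_collar`) it is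
an exterior-free CEILING on the torus state itself.  At sup-separated sites (`≥ 2R+4` apart on the torus, radius-`R+1`
femto cubes around them) the centred moments of the action density obey `|E_T ∏ᵢ(dens_{xᵢ} − E_T dens_{xᵢ})| ≤ (2C₁/R⁴)ⁿ`
(`abs_torusE_prod_centred_le_of_e1osc`); read at `n = 2, 3`:

* `abs_torusCov_dens_le_of_e1osc` — `|Cov_T(dens_x, dens_y)| ≤ (2C₁/R⁴)²`;
* `abs_torusK3_le_of_e1osc` — `|torusK3_T(x, y, z)| ≤ (2C₁/R⁴)³` (via `torusE_prod_centred_three_eq_torusCum3`);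
* `abs_Q2_le_of_pointwise`, `abs_Q3_le_of_pointwise` — smeared sums inherit any pointwise bound on charged pairs /
  triples: `|Q2(f, g)| ≤ S_f S_g · B`, `|Q3(f, g, h)| ≤ S_f S_g S_h · B` (`S_w = Σ_{x ∈ box} |w(s x)|`);

Sequels: `…NTCeilingPriceSmeared` (witness geometry ⇒ `|Q2_{β,L,s}(θv, v)| ≤ S_θ S_v (2C₁/R⁴)²`, `R ≈ δ/s`, and the
three-point twin), `…NTCeilingPricePackage` (the β-uniform numbers for the registered stub: the clause-4 floor `ε` and the
clause-4 MARGIN — whose `k·k'` part is `2C₁²(s/κ)⁸ S_θ S_v`, the SAME `S_θ S_v` — both sit under `4C₁² S_θ S_v/R⁸`, whence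
`ε ≤ 4C₁²K_θK_v/δ⁸`, `0 < C₁`, `δ < (4·2^{1/8} − 1)κ`).

HONEST FRAMING.  Finite-torus DLR bookkeeping over tree theorems at one coupling; no floor, no ceiling at large `β`, not
AF, not NT, not the seam, not the gap; not Clay.

Refs: `…LangevinControlUVOSLegsFromFemtoAndGapStubCollar` (`stub_collar`, followed verbatim), `…NTBoundaryLawCore`
(translation covariance of cube kernels), `…NTCumulantPolarisationDefs` (torus-expectation algebra, `torusCum3`),
`…NTReferenceMargins` / `…NTReferenceThreePointNoE2` (witness geometry), Georgii2011 Thm. 4.17, OsterwalderSeiler1978 §2.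
-/

set_option autoImplicit false

noncomputable section

open scoped SchwartzMap
open MeasureTheory Filter Topology
open Literature.MathematicalPhysics.QuantumFieldTheory Literature.MathematicalPhysics.QuantumLattice
open Literature.Probability.LatticeModels
open Summit.QuantumFields.YangMills.Cruxes.OSLegsFromFemtoAndGap.DlrCollarTransfer
open Summit.QuantumFields.YangMills.Cruxes.NT.BoundaryLaw (kerE_dens_configShift configShift_configShift)
open Summit.QuantumFields.YangMills.Cruxes.NT.CumulantPolarisation
  (torusE_sub torusCum3 torusK3_eq_torusCum3 torusE_centred_centred torusCum3_eq_cov_centred)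
open Summit.QuantumFields.YangMills.Cruxes.NT.MarkovMirror (torusE_add torusE_const_mul)

namespace Summit.QuantumFields.YangMills.Cruxes.NT.CeilingPrice

/-! ## §0 Small algebra -/

/-- Translation by `0` is the identity on configurations. [folklore] -/
theorem configShift_zero {G : Type} [MeasurableSpace G] (η : LGConfig 4 G) : configShift 0 η = η := by
  funext e
  simp [Literature.MathematicalPhysics.QuantumLattice.configShift_apply]

/-- The torus separation `|valMinAbs (x − y)|` is symmetric in `x, y`. [folklore] -/
theorem abs_valMinAbs_sub_comm (L : ℕ) (m n : ℤ) :
    |((((m - n : ℤ) : ZMod (2 * L + 1))).valMinAbs : ℤ)| = |((((n - m : ℤ) : ZMod (2 * L + 1))).valMinAbs : ℤ)| := by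
  have h : ((n - m : ℤ) : ZMod (2 * L + 1)) = -((m - n : ℤ) : ZMod (2 * L + 1)) := by push_cast; ring
  rw [h, Int.abs_eq_natAbs, Int.abs_eq_natAbs, ZMod.natAbs_valMinAbs_neg]

/-! ## §1 Centred torus moments of the action density under the one-point oscillation ceiling (one coupling) -/

section Torus

variable (G : Type) [Group G] [TopologicalSpace G] [IsTopologicalGroup G] [CompactSpace G]
  [MeasurableSpace G] [BorelSpace G] (r : LatticeRep G)

/-- **E1-osc caps the centred torus moments.**  At coupling `β` and spacing `α`, suppose every femto cube `(c, b)`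
(`b · α ≤ ℓ`) satisfies the one-point exterior-oscillation ceiling `|kerE^η(dens x) − kerE^{η'}(dens x)| ≤ C₁/depth(x)⁴`
(depth `≥ 1`).  Then on the torus of side `2L+1`, for `n` sites pairwise sup-separated (torus metric) by `≥ 2R+4` in some
coordinate, `1 ≤ R`, `(2R+3)α ≤ ℓ`, `4R+8 ≤ L`:
`|E_T ∏ᵢ (dens_{xᵢ} − E_T dens_{xᵢ})| ≤ (2C₁/R⁴)ⁿ` — the radius-`R+1` cubes around the sites are femto cubes whose centres
have depth `R+2`, all kernel means are within `C₁/(R+2)⁴ ≤ C₁/R⁴` of the kernel mean of the origin-centred cube with unit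
exterior (translation covariance + E1-osc), and the tree's abstract collar bound applies. [folklore] -/
theorem abs_torusE_prod_centred_le_of_e1osc (β : ℝ) {C₁ ℓ α : ℝ} (hC₁ : 0 ≤ C₁)
    (hE1 : ∀ (c : Fin 4 → ℤ) (b : ℕ), (b : ℝ) * α ≤ ℓ → ∀ (η η' : LGConfig 4 G) (x : Fin 4 → ℤ),
      1 ≤ depth c b x → |kerE G r β c b η (dens G r x) - kerE G r β c b η' (dens G r x)| ≤ C₁ / (depth c b x : ℝ) ^ 4)
    {L n : ℕ} (x : Fin n → (Fin 4 → ℤ)) {R : ℕ} (hR : 1 ≤ R) (hRℓ : ((2 * R + 3 : ℕ) : ℝ) * α ≤ ℓ)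
    (hRL : 4 * R + 8 ≤ L)
    (hsep : ∀ i j : Fin n, i ≠ j → ∃ k : Fin 4,
      (2 * (R : ℤ) + 4) ≤ |((((x i k - x j k : ℤ) : ZMod (2 * L + 1))).valMinAbs : ℤ)|) :
    |torusE G r β L (fun U => ∏ i, (dens G r (x i) U - torusE G r β L (dens G r (x i))))| ≤
      (2 * C₁ / (R : ℝ) ^ 4) ^ n := by
  haveI : SecondCountableTopology G :=
    (r.continuous.isClosedEmbedding r.injective).isEmbedding.secondCountableTopology
  obtain ⟨CA, hCA⟩ := r.curvature.bounded
  -- common reference value: kernel mean at the centre of the origin-centred cube of side `2R+3`, unit exterior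
  set p : ℝ := kerE G r β (fun k => (0 : Fin 4 → ℤ) k - ((R : ℤ) + 1)) (2 * R + 3) 1 (dens G r 0) with hp
  have hR' : (0 : ℝ) < R := Nat.cast_pos.2 (by omega)
  have hker : ∀ (i : Fin n) (η : LGConfig 4 G), |(∫ U, dens G r (x i) U ∂(ymSpecification r.ρ β
      (cubeEdges (fun k => x i k - (R + 1)) (2 * R + 3)) η)) - p| ≤ C₁ / (R : ℝ) ^ 4 := by
    intro i η
    -- translate the cube around `x i` to the origin
    have h := kerE_dens_configShift G r (x i) β (fun k => (0 : Fin 4 → ℤ) k - ((R : ℤ) + 1)) (2 * R + 3)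
      (configShift (-(x i)) η) 0
    have hc : ((fun k => (0 : Fin 4 → ℤ) k - ((R : ℤ) + 1)) + x i) = fun k => x i k - ((R : ℤ) + 1) := by
      funext k; simp only [Pi.add_apply, Pi.zero_apply]; ring
    rw [hc, configShift_configShift, add_neg_cancel, configShift_zero, zero_add] at h
    change |kerE G r β (fun k => x i k - ((R : ℤ) + 1)) (2 * R + 3) η (dens G r (x i)) - p| ≤ _
    rw [h, hp]
    have hd : depth (fun k => (0 : Fin 4 → ℤ) k - ((R : ℤ) + 1)) (2 * R + 3) 0 = R + 2 := depth_centred 0 R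
    have hd1 : 1 ≤ depth (fun k => (0 : Fin 4 → ℤ) k - ((R : ℤ) + 1)) (2 * R + 3) 0 := by rw [hd]; omega
    refine (hE1 _ _ hRℓ (configShift (-(x i)) η) 1 0 hd1).trans ?_
    rw [hd]
    push_cast
    refine div_le_div_of_nonneg_left hC₁ (pow_pos hR' 4) ?_
    gcongr
    linarith
  -- the data of the abstract collar bound: volumes = supports = the cubes (verbatim `stub_collar`)
  have hAc : ∀ i : Fin n, Continuous (dens G r (x i)) := fun i => continuous_dens r (x i)
  have hAb : ∀ (i : Fin n) (U : LGConfig 4 G), |dens G r (x i) U| ≤ CA := fun i U => hCA _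
  have hAS : ∀ i : Fin n, IsCylinder (dens G r (x i)) (cubeEdges (fun k => x i k - (R + 1)) (2 * R + 3)) :=
    fun i => isCylinder_dens_cube r hR (x i)
  have hinj : ∀ i : Fin n, Set.InjOn (Torus.proj (2 * L + 1))
      (((cubeEdges (fun k => x i k - (R + 1)) (2 * R + 3) ∪ cubeEdges (fun k => x i k - (R + 1)) (2 * R + 3) ∪
          (plaquettesTouching (cubeEdges (fun k => x i k - (R + 1)) (2 * R + 3))).biUnion plaquetteEdges).image
          Prod.fst : Set (Fin 4 → ℤ))) := fun i => injOn_torusProj_cube hRL (x i)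
  have hfar : ∀ i j : Fin n, i ≠ j → ∀ e ∈ cubeEdges (fun k => x j k - (R + 1)) (2 * R + 3) ∪
      (plaquettesTouching (cubeEdges (fun k => x j k - (R + 1)) (2 * R + 3))).biUnion plaquetteEdges,
      ∀ e' ∈ cubeEdges (fun k => x i k - (R + 1)) (2 * R + 3),
      torusEdge (2 * L + 1) e ≠ torusEdge (2 * L + 1) e' :=
    fun i j hij e he e' he' => torusEdge_ne_cube (hsep i j hij) he he'
  have hm : ∀ i : Fin n, torusE G r β L (dens G r (x i)) =
      ∫ W, dens G r (x i) (torusLift (2 * L + 1) W) ∂(wilsonMeasure r.ρ β) := fun i => rfl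
  have key := abs_integral_prod_sub_mean_le (d := 4) r.ρ r.continuous β (L := 2 * L + 1) (n := n)
    (fun i => cubeEdges (fun k => x i k - (R + 1)) (2 * R + 3))
    (fun i => cubeEdges (fun k => x i k - (R + 1)) (2 * R + 3))
    (fun i => dens G r (x i)) hAc hAb hAS hinj hfar (fun i => torusE G r β L (dens G r (x i))) hm hker
  rw [show (2 : ℝ) * (C₁ / (R : ℝ) ^ 4) = 2 * C₁ / (R : ℝ) ^ 4 from (mul_div_assoc _ _ _).symm] at key
  exact key

/-- **`n = 2`: E1-osc caps the torus covariance of the action density at sup-separated sites**: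
`|E_T[dens_x dens_y] − E_T[dens_x] E_T[dens_y]| ≤ (2C₁/R⁴)²`. [folklore] -/
theorem abs_torusCov_dens_le_of_e1osc (β : ℝ) {C₁ ℓ α : ℝ} (hC₁ : 0 ≤ C₁)
    (hE1 : ∀ (c : Fin 4 → ℤ) (b : ℕ), (b : ℝ) * α ≤ ℓ → ∀ (η η' : LGConfig 4 G) (x : Fin 4 → ℤ),
      1 ≤ depth c b x → |kerE G r β c b η (dens G r x) - kerE G r β c b η' (dens G r x)| ≤ C₁ / (depth c b x : ℝ) ^ 4)
    {L : ℕ} (x y : Fin 4 → ℤ) {R : ℕ} (hR : 1 ≤ R) (hRℓ : ((2 * R + 3 : ℕ) : ℝ) * α ≤ ℓ) (hRL : 4 * R + 8 ≤ L)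
    (hsep : ∃ k : Fin 4, (2 * (R : ℤ) + 4) ≤ |((((x k - y k : ℤ) : ZMod (2 * L + 1))).valMinAbs : ℤ)|) :
    |torusE G r β L (fun U => dens G r x U * dens G r y U) - torusE G r β L (dens G r x) * torusE G r β L (dens G r y)| ≤
      (2 * C₁ / (R : ℝ) ^ 4) ^ 2 := by
  have hsep' : ∀ i j : Fin 2, i ≠ j → ∃ k : Fin 4,
      (2 * (R : ℤ) + 4) ≤ |((((![x, y] i k - ![x, y] j k : ℤ) : ZMod (2 * L + 1))).valMinAbs : ℤ)| := by
    intro i j hij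
    fin_cases i <;> fin_cases j
    · exact absurd rfl hij
    · simpa using hsep
    · obtain ⟨k, hk⟩ := hsep
      rw [abs_valMinAbs_sub_comm L (x k) (y k)] at hk
      exact ⟨k, by simpa using hk⟩
    · exact absurd rfl hij
  have h := abs_torusE_prod_centred_le_of_e1osc G r β hC₁ hE1 ![x, y] hR hRℓ hRL hsep'
  have hprod : (fun U => ∏ i : Fin 2, (dens G r (![x, y] i) U - torusE G r β L (dens G r (![x, y] i)))) =
      fun U => (dens G r x U - torusE G r β L (dens G r x)) * (dens G r y U - torusE G r β L (dens G r y)) := by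
    funext U
    rw [Fin.prod_univ_two]
    simp
  rw [hprod, torusE_centred_centred G r β L (continuous_dens r x) (continuous_dens r y)] at h
  have e : torusE G r β L (fun U => dens G r x U * dens G r y U) -
        torusE G r β L (dens G r y) * torusE G r β L (dens G r x) -
        torusE G r β L (dens G r x) * torusE G r β L (dens G r y) +
        torusE G r β L (dens G r x) * torusE G r β L (dens G r y) =
      torusE G r β L (fun U => dens G r x U * dens G r y U) -
        torusE G r β L (dens G r x) * torusE G r β L (dens G r y) := by ring
  rwa [e] at h

/-- The centred third torus moment of three observables is their third cumulant `torusCum3`: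
`E_T[(A − E A)(B − E B)(C − E C)] = κ₃(A, B, C)`. [folklore] -/
theorem torusE_prod_centred_three_eq_torusCum3 (β : ℝ) (L : ℕ) {A B C : LGConfig 4 G → ℝ} (hA : Continuous A)
    (hB : Continuous B) (hC : Continuous C) :
    torusE G r β L (fun U => (A U - torusE G r β L A) * (B U - torusE G r β L B) * (C U - torusE G r β L C)) =
      torusCum3 G r β L A B C := by
  set a := torusE G r β L A
  set b := torusE G r β L B
  set c := torusE G r β L C
  have e1 : (fun U => (A U - a) * (B U - b) * (C U - c)) =
      fun U => ((B U - b) * (C U - c)) * A U - a * ((B U - b) * (C U - c)) := by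
    funext U; ring
  have hBC : Continuous fun U => (B U - b) * (C U - c) := (hB.sub continuous_const).mul (hC.sub continuous_const)
  have h1 : Continuous fun U => ((B U - b) * (C U - c)) * A U := hBC.mul hA
  have h2 : Continuous fun U => a * ((B U - b) * (C U - c)) := continuous_const.mul hBC
  rw [e1, torusE_sub G r β L h1 h2, torusE_const_mul G r β L a (fun U => (B U - b) * (C U - c)),
    torusCum3_eq_cov_centred G r β L hA hB hC]
  ring

/-- **`n = 3`: E1-osc caps the torus third cumulant of the action density at pairwise sup-separated sites**:
`|torusK3_T(x, y, z)| ≤ (2C₁/R⁴)³`. [folklore] -/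
theorem abs_torusK3_le_of_e1osc (β : ℝ) {C₁ ℓ α : ℝ} (hC₁ : 0 ≤ C₁)
    (hE1 : ∀ (c : Fin 4 → ℤ) (b : ℕ), (b : ℝ) * α ≤ ℓ → ∀ (η η' : LGConfig 4 G) (x : Fin 4 → ℤ),
      1 ≤ depth c b x → |kerE G r β c b η (dens G r x) - kerE G r β c b η' (dens G r x)| ≤ C₁ / (depth c b x : ℝ) ^ 4)
    {L : ℕ} (x y z : Fin 4 → ℤ) {R : ℕ} (hR : 1 ≤ R) (hRℓ : ((2 * R + 3 : ℕ) : ℝ) * α ≤ ℓ) (hRL : 4 * R + 8 ≤ L)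
    (hxy : ∃ k : Fin 4, (2 * (R : ℤ) + 4) ≤ |((((x k - y k : ℤ) : ZMod (2 * L + 1))).valMinAbs : ℤ)|)
    (hyz : ∃ k : Fin 4, (2 * (R : ℤ) + 4) ≤ |((((y k - z k : ℤ) : ZMod (2 * L + 1))).valMinAbs : ℤ)|)
    (hxz : ∃ k : Fin 4, (2 * (R : ℤ) + 4) ≤ |((((x k - z k : ℤ) : ZMod (2 * L + 1))).valMinAbs : ℤ)|) :
    |torusK3 G r β L x y z| ≤ (2 * C₁ / (R : ℝ) ^ 4) ^ 3 := by
  have flip : ∀ {u w : Fin 4 → ℤ}, (∃ k : Fin 4, (2 * (R : ℤ) + 4) ≤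
      |((((u k - w k : ℤ) : ZMod (2 * L + 1))).valMinAbs : ℤ)|) →
      ∃ k : Fin 4, (2 * (R : ℤ) + 4) ≤ |((((w k - u k : ℤ) : ZMod (2 * L + 1))).valMinAbs : ℤ)| := by
    rintro u w ⟨k, hk⟩
    rw [abs_valMinAbs_sub_comm L (u k) (w k)] at hk
    exact ⟨k, hk⟩
  have hsep' : ∀ i j : Fin 3, i ≠ j → ∃ k : Fin 4,
      (2 * (R : ℤ) + 4) ≤ |((((![x, y, z] i k - ![x, y, z] j k : ℤ) : ZMod (2 * L + 1))).valMinAbs : ℤ)| := by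
    intro i j hij
    fin_cases i <;> fin_cases j
    · exact absurd rfl hij
    · simpa using hxy
    · simpa using hxz
    · simpa using flip hxy
    · exact absurd rfl hij
    · simpa using hyz
    · simpa using flip hxz
    · simpa using flip hyz
    · exact absurd rfl hij
  have h := abs_torusE_prod_centred_le_of_e1osc G r β hC₁ hE1 ![x, y, z] hR hRℓ hRL hsep'
  have hprod : (fun U => ∏ i : Fin 3, (dens G r (![x, y, z] i) U - torusE G r β L (dens G r (![x, y, z] i)))) =
      fun U => (dens G r x U - torusE G r β L (dens G r x)) * (dens G r y U - torusE G r β L (dens G r y)) *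
        (dens G r z U - torusE G r β L (dens G r z)) := by
    funext U
    rw [Fin.prod_univ_three]
    simp
  rw [hprod, torusE_prod_centred_three_eq_torusCum3 G r β L (continuous_dens r x) (continuous_dens r y)
    (continuous_dens r z), ← torusK3_eq_torusCum3] at h
  exact h

/-! ## §2 Smeared sums inherit pointwise bounds on the charged pairs / triples -/

/-- **`|Q2(f, g)| ≤ S_f · S_g · B`** whenever the torus covariance of the action densities is bounded by `B` on every
pair of lattice points charged by `f` and `g` (`S_w = Σ_{x ∈ box L} |w(s x)|`). [folklore] -/
theorem abs_Q2_le_of_pointwise (β : ℝ) (L : ℕ) (s : ℝ) (f g : 𝓢(EuclideanSpace ℝ (Fin 4), ℝ)) {B : ℝ}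
    (hB : ∀ x ∈ box 4 L, ∀ y ∈ box 4 L, f (s • siteToE x) ≠ 0 → g (s • siteToE y) ≠ 0 →
      |torusE G r β L (fun U => dens G r x U * dens G r y U) - torusE G r β L (dens G r x) * torusE G r β L (dens G r y)|
        ≤ B) :
    |Q2 G r β L s f g| ≤
      (∑ x ∈ box 4 L, |f (s • siteToE x)|) * (∑ y ∈ box 4 L, |g (s • siteToE y)|) * B := by
  unfold Q2
  rw [Finset.sum_mul_sum, Finset.sum_mul]
  refine (Finset.abs_sum_le_sum_abs _ _).trans (Finset.sum_le_sum fun x hx => ?_)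
  rw [Finset.sum_mul]
  refine (Finset.abs_sum_le_sum_abs _ _).trans (Finset.sum_le_sum fun y hy => ?_)
  rw [abs_mul, abs_mul]
  by_cases hf : f (s • siteToE x) = 0
  · simp [hf]
  by_cases hg : g (s • siteToE y) = 0
  · simp [hg]
  exact mul_le_mul_of_nonneg_left (hB x hx y hy hf hg) (by positivity)

/-- **`|Q3(f, g, h)| ≤ S_f · S_g · S_h · B`** whenever the torus third cumulant of the action densities is bounded by `B`
on every triple of lattice points charged by `f`, `g`, `h`. [folklore] -/
theorem abs_Q3_le_of_pointwise (β : ℝ) (L : ℕ) (s : ℝ) (f g h : 𝓢(EuclideanSpace ℝ (Fin 4), ℝ)) {B : ℝ}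
    (hB : ∀ x ∈ box 4 L, ∀ y ∈ box 4 L, ∀ z ∈ box 4 L, f (s • siteToE x) ≠ 0 → g (s • siteToE y) ≠ 0 →
      h (s • siteToE z) ≠ 0 → |torusK3 G r β L x y z| ≤ B) :
    |Q3 G r β L s f g h| ≤
      (∑ x ∈ box 4 L, |f (s • siteToE x)|) * (∑ y ∈ box 4 L, |g (s • siteToE y)|) *
        (∑ z ∈ box 4 L, |h (s • siteToE z)|) * B := by
  unfold Q3
  rw [Finset.sum_mul_sum, Finset.sum_mul, Finset.sum_mul]
  refine (Finset.abs_sum_le_sum_abs _ _).trans (Finset.sum_le_sum fun x hx => ?_)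
  rw [Finset.sum_mul, Finset.sum_mul]
  refine (Finset.abs_sum_le_sum_abs _ _).trans (Finset.sum_le_sum fun y hy => ?_)
  rw [Finset.mul_sum, Finset.sum_mul]
  refine (Finset.abs_sum_le_sum_abs _ _).trans (Finset.sum_le_sum fun z hz => ?_)
  rw [abs_mul, abs_mul, abs_mul]
  by_cases hf : f (s • siteToE x) = 0
  · simp [hf]
  by_cases hg : g (s • siteToE y) = 0
  · simp [hg]
  by_cases hh : h (s • siteToE z) = 0
  · simp [hh]
  exact mul_le_mul_of_nonneg_left (hB x hx y hy z hz hf hg hh) (by positivity)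

end Torus

end Summit.QuantumFields.YangMills.Cruxes.NT.CeilingPrice

end
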